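import Summits.QuantumFields.YangMills.Theorems.BalabanUVNodesN15KingModelOSReconstruction
import Summits.QuantumFields.YangMills.Theorems.BalabanUVNodesN15KingModelOSExponentialDensity
import Literature.MathematicalPhysics.QuantumFieldTheory.LatticeMassGapProofs

/-!
# BalabanUVNodes ∕ N15 — THE KING-MODEL RUNG (PART Ͳ-d₃): THE MASS GAP OF THE TRANSFER OPERATOR OF KING's INFINITE-VOLUME BLOCK FIELD —
# `‖T|_{Ω^⊥}‖ ≤ e^{−√m²}` (the tree's `TransferData.HasMassGap (√m²)`), AND EXPONENTIAL CLUSTERING OF ALL BOUNDED POSITIVE-TIME OBSERVABLES AT RATE `√m²`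
# (Track A, DAG node N15 = NE2; FAN-OUT v1.1 §N15 s3 «KING-MODEL RUNG»; count-neutral)

HONEST FRAMING.  Count-neutral (cell `pub-ymgap`, seat `pub-ymgap-dag-n15-e` g36; `--supports stmt-QuantumFields-27366 --as helper` = K3⁸).  King's `A = 0`, `g = 0` model
([King1986] C. King, Commun. Math. Phys. **102** (1986) 649–677): the FREE massive block field `μ_∞` and its Osterwalder–Schrader reconstruction of part Ͳ-c₂ (the tree's `rpMap`,
`rpTransferData`).  ★ the OS seminorm is dominated by `L²(μ_∞)` (`‖ιF − ιP‖² ≤ ∫‖F − P‖² dμ_∞`); ★★ hence, by part Ͳ-d₂, `ι(exponential algebra)` is DENSE in the OS Hilbert space;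
★★ by part Ͳ-d₁ the matrix elements `⟪ιF, T^t ιF⟫ − ⟪ιF,Ω⟫⟪Ω,ιF⟫` of every exponential observable cluster at rate `(1−ε)√m²`; so the TREE's `gapNorm_le_exp_of_dense_clustering`
(Glimm–Jaffe Thm. 6.1.3 (iii) ∕ §19.7, iterated Schwarz inequality) gives `‖T P_{Ω^⊥}‖ ≤ e^{−(1−ε)√m²}` for every `ε ∈ (0,1]`, and letting `ε ↓ 0`: ★★★ **`king_hasMassGap :
(rpTransferData …).HasMassGap (√m²)`** — THE TRANSFER OPERATOR OF KING's BLOCK FIELD HAS A MASS GAP `≥ √m²` in the tree's sense (`spec T ⊆ {1} ∪ [0, e^{−m}]`).  As a COROLLARY, by the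
tree's `IsOSRealisation.hasTimeClustering_of_hasMassGap_holds`: ★★★ **`king_hasTimeClustering`** — EVERY pair of bounded positive-time observables clusters exponentially in time at rate
`√m²`: `|∫ conj F(φ∘θ)·G(S^tφ) dμ_∞ − (∫ conj F(φ∘θ))(∫ G)| ≤ C_{F,G} e^{−√m² t}`.  HONEST: this is the FREE field — the gap IS the input mass; the content is that King's `K = |Ω| = ∞`
block field is an honest inhabitant, BY CONSTRUCTION AND BY NAME, of the tree's lattice Osterwalder–Schrader ∕ transfer-operator ∕ mass-gap interfaces (`IsRPMeasureData`,
`IsOSRealisation`, `TransferData.HasMassGap`, `HasTimeClustering`).  NOT Bałaban's objects; NOT a node discharge; nothing about Yang–Mills ∕ continuum ∕ `ℝ⁴` ∕ Clay.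
0 `sorry`, 0 def; standard axioms.

WHAT THIS FILE PROVES (kernel).  §1 `re_integral_conj_mul_le_integral_normSq`, ★ `king_norm_rpMap_sub_sq_le`; §2 ★★ `king_rpMap_mem_closure_trigPoly`, ★★ `king_dense_rpMap_trigPoly`;
§3 ★★ `king_trigPoly_clustering`, ★★★ `king_gapNorm_le_exp`; §4 ★★★ **`king_hasMassGap`**, `king_massGap_ge`, ★★★ **`king_hasTimeClustering`**.

HONEST SCOPE.  King's free infinite-volume block field (`m² > 0`, every `d`).  N15 untouched; counts unmoved.
Locators (use): [King1986] Thm 2.1 (2.22)–(2.23) p.654, Thm 3.3 (3.6) p.656; Glimm–Jaffe 1987 §6.1 Thm. 6.1.3, §19.7 Thm. 19.7.1; Osterwalder–Seiler 1978 §2.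
-/

noncomputable section

open scoped BigOperators Topology ComplexConjugate InnerProductSpace
open Filter MeasureTheory ProbabilityTheory Finset Complex

namespace Summit.QuantumFields.YangMills.BalabanUVNodes.N15KingModelRung.InfiniteVolume

open Literature.MathematicalPhysics.QuantumFieldTheory (latticeTimeReflection positiveTimeSites positiveTimeEvents latticeTimeShift
  gapNorm_le_exp_of_dense_clustering)
open Literature.Probability.LatticeModels (configReflect configReflect_apply IsBoundedMeasurable IsRPMeasureData IsOSRealisation TransferData HasTimeClustering
  rpMap rpTransferData rpMap_of_mem osMap norm_osMap_sq bddMeasurable IsOSRealisation.hasTimeClustering_of_hasMassGap_holds)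

variable {d : ℕ}

/-! ## §1 The OS seminorm is dominated by `L²(μ_∞)` -/

/-- `Re ∫ conj(D(θω))·D(ω) dμ ≤ ∫ ‖D‖² dμ` for a bounded measurable `D` and a `μ`-preserving `θ` (AM–GM + invariance). [cite: GlimmJaffe1987, §6.1 (6.1.12)] -/
theorem re_integral_conj_mul_le_integral_normSq {Ω : Type*} [MeasurableSpace Ω] {μ : Measure Ω} [IsFiniteMeasure μ] {θ : Ω → Ω}
    (hθ : MeasurePreserving θ μ μ) {D : Ω → ℂ} (hDm : Measurable D) {C : ℝ} (hDb : ∀ ω, ‖D ω‖ ≤ C) :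
    RCLike.re (∫ ω, conj (D (θ ω)) * D ω ∂μ) ≤ ∫ ω, ‖D ω‖ ^ 2 ∂μ := by
  have hsq : Integrable (fun ω => ‖D ω‖ ^ 2) μ :=
    Integrable.of_bound ((hDm.norm).pow_const 2).aestronglyMeasurable (C ^ 2) (ae_of_all _ fun ω => by
      rw [Real.norm_eq_abs, abs_pow, abs_norm]
      exact pow_le_pow_left₀ (norm_nonneg _) (hDb ω) 2)
  have hsqθ : Integrable (fun ω => ‖D (θ ω)‖ ^ 2) μ := hθ.integrable_comp_of_integrable hsq
  have hinv : ∫ ω, ‖D (θ ω)‖ ^ 2 ∂μ = ∫ ω, ‖D ω‖ ^ 2 ∂μ := by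
    have h := integral_map (μ := μ) hθ.measurable.aemeasurable (f := fun y => ‖D y‖ ^ 2) ((hDm.norm).pow_const 2).aestronglyMeasurable
    rw [hθ.map_eq] at h
    exact h.symm
  calc RCLike.re (∫ ω, conj (D (θ ω)) * D ω ∂μ) ≤ ‖∫ ω, conj (D (θ ω)) * D ω ∂μ‖ := RCLike.re_le_norm _
    _ ≤ ∫ ω, ‖conj (D (θ ω)) * D ω‖ ∂μ := norm_integral_le_integral_norm _
    _ ≤ ∫ ω, (‖D (θ ω)‖ ^ 2 + ‖D ω‖ ^ 2) / 2 ∂μ := by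
        refine integral_mono_of_nonneg (ae_of_all _ fun ω => norm_nonneg _) ((hsqθ.add hsq).div_const 2) (ae_of_all _ fun ω => ?_)
        simp only [norm_mul, Complex.norm_conj]
        nlinarith [sq_nonneg (‖D (θ ω)‖ - ‖D ω‖)]
    _ = ∫ ω, ‖D ω‖ ^ 2 ∂μ := by
        rw [integral_div, integral_add hsqθ hsq, hinv]; ring

/-- ★ **THE OS SEMINORM OF KING's BLOCK FIELD IS DOMINATED BY `L²(μ_∞)`**: `‖ιF − ιP‖² ≤ ∫ ‖F − P‖² dμ_∞` for bounded positive-time observables `F, P`. [cite: GlimmJaffe1987, §6.1 (6.1.12)] -/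
theorem king_norm_rpMap_sub_sq_le {m2 : ℝ} (hm : 0 < m2) {F P : ((Fin (d + 1) → ℤ) → ℝ) → ℂ} (hF : IsBoundedMeasurable (positiveTimeEvents (d + 1) ℝ) F)
    (hP : IsBoundedMeasurable (positiveTimeEvents (d + 1) ℝ) P) :
    ‖rpMap (king_isRPMeasureData (d := d) hm) F - rpMap (king_isRPMeasureData hm) P‖ ^ 2 ≤ ∫ ω, ‖F ω - P ω‖ ^ 2 ∂kingFieldInf m2 := by
  haveI := isProbabilityMeasure_kingFieldInf (d := d) hm
  set h := king_isRPMeasureData (d := d) hm with hh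
  have hFP : IsBoundedMeasurable (positiveTimeEvents (d + 1) ℝ) (F - P) :=
    (bddMeasurable (positiveTimeEvents (d + 1) ℝ)).sub_mem hF hP
  have hsub : rpMap h F - rpMap h P = osMap h.core ((⟨F, hF⟩ : bddMeasurable (positiveTimeEvents (d + 1) ℝ)) - ⟨P, hP⟩) := by
    rw [rpMap_of_mem h hF, rpMap_of_mem h hP, map_sub]
  rw [hsub, norm_osMap_sq, IsRPMeasureData.core_inner]
  obtain ⟨CF, hCF⟩ := hF.2
  obtain ⟨CP, hCP⟩ := hP.2
  have hDm : Measurable (F - P) := hFP.1.mono cylinderEvents_le_pi le_rfl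
  have hDb : ∀ ω, ‖(F - P) ω‖ ≤ CF + CP := fun ω => by
    rw [Pi.sub_apply]
    exact (norm_sub_le _ _).trans (add_le_add (hCF ω) (hCP ω))
  exact re_integral_conj_mul_le_integral_normSq h.measurePreserving_reflect hDm hDb

/-! ## §2 `ι(exponential algebra)` is dense in the OS Hilbert space -/

/-- ★★ For every bounded positive-time `F`, `ιF` lies in the closure of `ι(trigonometric polynomials supported in {x₀ ≥ 0})`. [cite: GlimmJaffe1987, §6.1 Thm. 6.1.3 (𝓔₊)] -/
theorem king_rpMap_mem_closure_trigPoly {m2 : ℝ} (hm : 0 < m2) {F : ((Fin (d + 1) → ℤ) → ℝ) → ℂ} (hF : IsBoundedMeasurable (positiveTimeEvents (d + 1) ℝ) F) :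
    rpMap (king_isRPMeasureData (d := d) hm) F ∈ closure (rpMap (king_isRPMeasureData (d := d) hm) ''
      {P | ∃ (n : ℕ) (a : Fin n → ℂ) (s : Finset (Fin (d + 1) → ℤ)) (_ : ∀ z ∈ s, z ∈ positiveTimeSites (d + 1)) (f : Fin n → (Fin (d + 1) → ℤ) → ℝ),
        P = fun ω => ∑ k, a k * Complex.exp (((∑ z ∈ s, f k z * ω z : ℝ) : ℂ) * I)}) := by
  rw [Metric.mem_closure_iff]
  intro r hr
  obtain ⟨n, a, s, hs, f, happ⟩ := king_exists_trigPoly_integral_normSq_sub_lt (d := d) hm hF (pow_pos hr 2)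
  have hPbdd := isBoundedMeasurable_trigPoly (d := d) a hs f
  refine ⟨rpMap (king_isRPMeasureData hm) (fun ω => ∑ k, a k * Complex.exp (((∑ z ∈ s, f k z * ω z : ℝ) : ℂ) * I)), ⟨_, ⟨n, a, s, hs, f, rfl⟩, rfl⟩, ?_⟩
  rw [dist_eq_norm]
  have hsq := (king_norm_rpMap_sub_sq_le hm hF hPbdd).trans_lt happ
  exact lt_of_pow_lt_pow_left₀ 2 hr.le hsq

/-- ★★ **`ι(EXPONENTIAL ALGEBRA)` IS DENSE IN THE OS HILBERT SPACE OF KING's BLOCK FIELD.** [cite: GlimmJaffe1987, §6.1 Thm. 6.1.3 (𝓔₊)] -/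
theorem king_dense_rpMap_trigPoly {m2 : ℝ} (hm : 0 < m2) :
    Dense (rpMap (king_isRPMeasureData (d := d) hm) ''
      {P | ∃ (n : ℕ) (a : Fin n → ℂ) (s : Finset (Fin (d + 1) → ℤ)) (_ : ∀ z ∈ s, z ∈ positiveTimeSites (d + 1)) (f : Fin n → (Fin (d + 1) → ℤ) → ℝ),
        P = fun ω => ∑ k, a k * Complex.exp (((∑ z ∈ s, f k z * ω z : ℝ) : ℂ) * I)}) := by
  have hB := (king_isOSRealisation (d := d) hm).dense
  rw [← dense_closure]
  refine hB.mono ?_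
  rintro _ ⟨F, hF, rfl⟩
  exact king_rpMap_mem_closure_trigPoly hm hF

/-! ## §3 Clustering on the dense set, and the gap norm -/

/-- ★★ **CLUSTERING OF THE MATRIX ELEMENTS ON THE EXPONENTIAL ALGEBRA**: for every exponential observable `P` and `0 < ε ≤ 1` there is `C` with
`‖⟪ιP, T^t ιP⟫ − ⟪ιP, Ω⟫⟪Ω, ιP⟫‖ ≤ C e^{−(1−ε)√m² t}` (part Ͳ-d₁ read through the OS realisation). [cite: GlimmJaffe1987, §19.7 Thm. 19.7.1; King1986, Thm 3.3 (3.6) p.656] -/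
theorem king_trigPoly_clustering {m2 ε : ℝ} (hm : 0 < m2) (hε0 : 0 < ε) (hε1 : ε ≤ 1) {n : ℕ} (a : Fin n → ℂ) {s : Finset (Fin (d + 1) → ℤ)}
    (hs : ∀ z ∈ s, z ∈ positiveTimeSites (d + 1)) (f : Fin n → (Fin (d + 1) → ℤ) → ℝ) :
    ∃ C : ℝ, ∀ t : ℕ,
      ‖⟪rpMap (king_isRPMeasureData (d := d) hm) (fun ω => ∑ k, a k * Complex.exp (((∑ z ∈ s, f k z * ω z : ℝ) : ℂ) * I)),
          ((rpTransferData (king_isRPMeasureData hm) (king_shift_nonneg hm)).T ^ t)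
            (rpMap (king_isRPMeasureData hm) (fun ω => ∑ k, a k * Complex.exp (((∑ z ∈ s, f k z * ω z : ℝ) : ℂ) * I)))⟫_ℂ
        - ⟪rpMap (king_isRPMeasureData hm) (fun ω => ∑ k, a k * Complex.exp (((∑ z ∈ s, f k z * ω z : ℝ) : ℂ) * I)),
            (rpTransferData (king_isRPMeasureData hm) (king_shift_nonneg hm)).vacuum⟫_ℂ
          * ⟪(rpTransferData (king_isRPMeasureData hm) (king_shift_nonneg hm)).vacuum,
            rpMap (king_isRPMeasureData hm) (fun ω => ∑ k, a k * Complex.exp (((∑ z ∈ s, f k z * ω z : ℝ) : ℂ) * I))⟫_ℂ‖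
        ≤ C * Real.exp (-((1 - ε) * Real.sqrt m2) * t) := by
  have hOS := king_isOSRealisation (d := d) hm
  have hP := isBoundedMeasurable_trigPoly (d := d) a hs f
  obtain ⟨C, hC⟩ := os_truncated_trigPoly_norm_le (d := d) hm hε0 hε1 a s f
  refine ⟨C, fun t => ?_⟩
  have h := hC t
  rwa [hOS.integral_conj_comp_reflect_mul_comp_iterate hP hP t, hOS.integral_conj_comp_reflect hP, hOS.integral_eq_inner_vacuum hP] at h

/-- ★★★ **THE GAP NORM OF KING's TRANSFER OPERATOR**: `‖T P_{Ω^⊥}‖ ≤ e^{−(1−ε)√m²}` for every `0 < ε ≤ 1` (the tree's `gapNorm_le_exp_of_dense_clustering` on the dense exponential algebra).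
[cite: GlimmJaffe1987, §6.1 Thm. 6.1.3 (iii), §19.7 Thm. 19.7.1; King1986, Thm 3.3 (3.6) p.656] -/
theorem king_gapNorm_le_exp {m2 ε : ℝ} (hm : 0 < m2) (hε0 : 0 < ε) (hε1 : ε ≤ 1) :
    (rpTransferData (king_isRPMeasureData (d := d) hm) (king_shift_nonneg hm)).gapNorm ≤ Real.exp (-((1 - ε) * Real.sqrt m2)) := by
  refine gapNorm_le_exp_of_dense_clustering _ ((1 - ε) * Real.sqrt m2) (king_dense_rpMap_trigPoly hm) ?_
  rintro _ ⟨P, ⟨n, a, s, hs, f, rfl⟩, rfl⟩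
  exact king_trigPoly_clustering hm hε0 hε1 a hs f

/-! ## §4 The mass gap and exponential clustering of all bounded observables -/

/-- ★★★ **THE TRANSFER OPERATOR OF KING's INFINITE-VOLUME BLOCK FIELD HAS A MASS GAP `≥ √m²`**: `‖T P_{Ω^⊥}‖ ≤ e^{−√m²}` — the tree's `TransferData.HasMassGap (√m²)` for the
Osterwalder–Schrader reconstruction of `μ_∞` (letting `ε ↓ 0` in `king_gapNorm_le_exp`). [cite: King1986, Thm 2.1 (2.22)–(2.23) p.654, Thm 3.3 (3.6) p.656; GlimmJaffe1987, §6.1 Thm. 6.1.3, §19.7] -/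
theorem king_hasMassGap {m2 : ℝ} (hm : 0 < m2) :
    (rpTransferData (king_isRPMeasureData (d := d) hm) (king_shift_nonneg hm)).HasMassGap (Real.sqrt m2) := by
  refine ⟨Real.sqrt_pos.mpr hm, ?_⟩
  have hcont : Tendsto (fun ε : ℝ => Real.exp (-((1 - ε) * Real.sqrt m2))) (𝓝[>] 0) (𝓝 (Real.exp (-Real.sqrt m2))) := by
    have h : Continuous fun ε : ℝ => Real.exp (-((1 - ε) * Real.sqrt m2)) := by fun_prop
    have h0 := h.tendsto 0
    simp only [sub_zero, one_mul] at h0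
    exact tendsto_nhdsWithin_of_tendsto_nhds h0
  refine ge_of_tendsto hcont ?_
  filter_upwards [Ioo_mem_nhdsGT (zero_lt_one' ℝ)] with ε hε
  exact king_gapNorm_le_exp hm hε.1 hε.2.le

/-- The mass gap of King's transfer data is at least `√m²` (tree's `EReal`-valued `massGap`). [cite: GlimmJaffe1987, §6.1] -/
theorem king_massGap_ge {m2 : ℝ} (hm : 0 < m2) :
    ((Real.sqrt m2 : ℝ) : EReal) ≤ (rpTransferData (king_isRPMeasureData (d := d) hm) (king_shift_nonneg hm)).massGap :=
  (king_hasMassGap hm).le_massGap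

/-- ★★★ **EXPONENTIAL CLUSTERING OF ALL BOUNDED POSITIVE-TIME OBSERVABLES OF KING's BLOCK FIELD AT RATE `√m²`**: for all bounded `F, G` measurable in `{φ(x) : x₀ ≥ 0}` there is `C`
with `‖∫ conj F(φ∘θ)·G(S^tφ) dμ_∞ − (∫ conj F(φ∘θ) dμ_∞)(∫ G dμ_∞)‖ ≤ C e^{−√m²·t}` for all `t ∈ ℕ` — the tree's `HasTimeClustering`, from the mass gap by
`IsOSRealisation.hasTimeClustering_of_hasMassGap_holds`. [cite: King1986, Thm 3.3 (3.6) p.656; GlimmJaffe1987, §6.1 Thm. 6.1.3, §19.7] -/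
theorem king_hasTimeClustering {m2 : ℝ} (hm : 0 < m2) :
    HasTimeClustering (kingFieldInf (d := d) m2) (configReflect (latticeTimeReflection (d + 1))) (latticeTimeShift (d + 1) ℝ)
      (positiveTimeEvents (d + 1) ℝ) (Real.sqrt m2) :=
  IsOSRealisation.hasTimeClustering_of_hasMassGap_holds (king_isOSRealisation (d := d) hm) (king_hasMassGap hm)

end Summit.QuantumFields.YangMills.BalabanUVNodes.N15KingModelRung.InfiniteVolume
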